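import Summits.PneNP.PneNP.Theses.MonochromaticLines
import Literature.Combinatorics.Additive.TricoloredSumFreeBound

/-!
# Route MonochromaticLines — `MonoLineTotal` (stmt-PneNP-11758)

Totality of MONO-LINE (hypothesis `hT` of the route's deciding theorem): for `n ≥ 200` every colouring
`c : ℕ → (Fin ⌊n/10⌋ → Bool)` admits pairwise distinct `x, y, z < 3ⁿ` with digitwise `x + y + z ≡ 0 (mod 3)` and
`c x = c y = c z`. Proof: identify `[0, 3ⁿ)` with `𝔽₃ⁿ` through base-`3` digits (`Nat.ofDigits`); the largest colour class
`A` has `|A| ≥ 3ⁿ / 2^⌊n/10⌋` (pigeonhole); if `A` contained no line then `(incl, incl, incl)` on `A` would be a tricolored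
sum-free set, so `|A| ≤ 3 · #LowWeight₃(n)` by the slice-rank bound of the tree
(`IsTricoloredSumFree.card_le_of_addEquiv`, BCCGNSU 2017 Thm. 4.14, i.e. Ellenberg–Gijswijt), and
`#LowWeight₃(n) ≤ θⁿ`, `θ = (1 + v³ + v⁶)/v²` at `v = 21/25` (`card_lowWeight_mul_pow_le`), `θ < 2.7552`; but
`4 · 2^⌊n/10⌋ · θⁿ < 3ⁿ` for `n ≥ 200`.
-/

set_option linter.dupNamespace false -- `Summit.PneNP.PneNP.…`: summit = sub-problem name (D-0017 single-conjunct layout)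

namespace Summit.PneNP.PneNP.Theorems

open Finset
open Literature.Combinatorics.Additive

/-- The numeric heart: `4 · 2^⌊n/10⌋ · θⁿ < 3ⁿ` for `n ≥ 200`, `θ = (1 + v³ + v⁶)/v²`, `v = 21/25`. [folklore] -/
theorem monoLine_numeric (n : ℕ) (hn : 200 ≤ n) :
    (4 : ℝ) * 2 ^ (n / 10) * ((1 + (21 / 25 : ℝ) ^ 3 + (21 / 25) ^ 6) / (21 / 25) ^ 2) ^ n < 3 ^ n := by
  set θ : ℝ := (1 + (21 / 25 : ℝ) ^ 3 + (21 / 25) ^ 6) / (21 / 25) ^ 2 with hθ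
  have hθ0 : 0 ≤ θ := by rw [hθ]; positivity
  have hθle : θ ≤ 1722 / 625 := by rw [hθ]; norm_num
  obtain ⟨k, s, hs, rfl⟩ : ∃ k s, s < 10 ∧ n = 10 * k + s :=
    ⟨n / 10, n % 10, Nat.mod_lt _ (by norm_num), (Nat.div_add_mod n 10).symm⟩
  have hk : 20 ≤ k := by omega
  have hdiv : (10 * k + s) / 10 = k := by omega
  rw [hdiv]
  have hc : 2 * (1722 / 625 : ℝ) ^ 10 ≤ (100 / 117) * 3 ^ 10 := by norm_num
  have hs3 : (1722 / 625 : ℝ) ^ s ≤ 3 ^ s := pow_le_pow_left₀ (by norm_num) (by norm_num) s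
  have hk4 : 4 * (100 / 117 : ℝ) ^ k < 1 :=
    calc 4 * (100 / 117 : ℝ) ^ k ≤ 4 * (100 / 117) ^ 20 :=
          mul_le_mul_of_nonneg_left (pow_le_pow_of_le_one (a := (100 / 117 : ℝ)) (by norm_num) (by norm_num) hk)
            (by norm_num)
      _ < 1 := by norm_num
  calc (4 : ℝ) * 2 ^ k * θ ^ (10 * k + s) ≤ 4 * 2 ^ k * (1722 / 625) ^ (10 * k + s) := by gcongr
    _ = 4 * (2 * (1722 / 625 : ℝ) ^ 10) ^ k * (1722 / 625) ^ s := by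
        rw [pow_add, pow_mul, mul_pow, ← pow_mul]; ring
    _ ≤ 4 * ((100 / 117) * 3 ^ 10) ^ k * 3 ^ s := by gcongr
    _ = (4 * (100 / 117) ^ k) * ((3 ^ 10) ^ k * 3 ^ s) := by rw [mul_pow]; ring
    _ < 1 * ((3 ^ 10) ^ k * 3 ^ s) := by apply mul_lt_mul_of_pos_right hk4; positivity
    _ = 3 ^ (10 * k + s) := by rw [pow_add, pow_mul]; ring

/-- Base-`3` digit extraction from `Nat.ofDigits 3 (List.ofFn F)`. [folklore] -/
theorem ofDigits_ofFn_digit {n : ℕ} (F : Fin n → ℕ) (hF : ∀ l, F l < 3) (l : ℕ) (hl : l < n) :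
    Nat.ofDigits 3 (List.ofFn F) / 3 ^ l % 3 = F ⟨l, hl⟩ := by
  rw [Nat.ofDigits_div_pow_eq_ofDigits_drop _ (by norm_num) _ (List.forall_mem_ofFn_iff.2 hF),
    Nat.ofDigits_mod_eq_head!]
  have hl' : l < (List.ofFn F).length := by simpa using hl
  rw [List.drop_eq_getElem_cons hl', List.head!_cons, List.getElem_ofFn]
  exact Nat.mod_eq_of_lt (hF _)

/-- **Support item `MonoLineTotal` of route MonochromaticLines (stmt-PneNP-11758)**: for `n ≥ 200` every colouring of `[0,3ⁿ)` with
`2^⌊n/10⌋` colours has a monochromatic combinatorial line (cap-set bound via slice rank).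
[cite: BlasiakChurchCohnGrochowNaslundSawinUmans2017, Thm. 4.14] [cite: EllenbergGijswijt2017, Thm. 1] -/
theorem monochromaticLines_monoLineTotal_proof : Summit.PneNP.PneNP.Theses.MonochromaticLines.MonoLineTotal := by
  unfold Summit.PneNP.PneNP.Theses.MonochromaticLines.MonoLineTotal
  intro IsLine n hn c
  have d0 : ∀ x : ZMod 3, x + x + x = 0 := by decide
  have d1 : ∀ x y : ZMod 3, x + x + y = 0 → y = x := by decide
  have d2 : ∀ x y : ZMod 3, x + y + y = 0 → x = y := by decide
  have d3 : ∀ x y : ZMod 3, x + y + x = 0 → y = x := by decide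
  classical
  by_contra hno
  haveI : Fact (Nat.Prime 3) := ⟨Nat.prime_three⟩
  -- numbers ↔ vectors
  let N : (Fin n → ZMod 3) → ℕ := fun g => Nat.ofDigits 3 (List.ofFn fun l => (g l).val)
  have hval3 : ∀ (g : Fin n → ZMod 3) (l : Fin n), (g l).val < 3 := fun g l => ZMod.val_lt _
  have hNlt : ∀ g, N g < 3 ^ n := fun g => by
    have h := Nat.ofDigits_lt_base_pow_length (b := 3) (by norm_num) (List.forall_mem_ofFn_iff.2 (hval3 g))
    simpa [N] using h
  have hNdig : ∀ (g : Fin n → ZMod 3) (l : ℕ) (hl : l < n), N g / 3 ^ l % 3 = (g ⟨l, hl⟩).val :=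
    fun g l hl => ofDigits_ofFn_digit _ (hval3 g) l hl
  have hNinj : Function.Injective N := by
    intro g g' h
    funext l
    apply ZMod.val_injective
    rw [← hNdig g l l.isLt, ← hNdig g' l l.isLt, h]
  -- the largest colour class
  let c' : (Fin n → ZMod 3) → (Fin (n / 10) → Bool) := fun g => c (N g)
  have hcardβ : Fintype.card (Fin (n / 10) → Bool) = 2 ^ (n / 10) := by simp
  have hcardH : Fintype.card (Fin n → ZMod 3) = 3 ^ n := by simp [ZMod.card]
  obtain ⟨κ, hκ⟩ := Fintype.exists_le_card_fiber_of_mul_le_card (f := c') (n := 3 ^ n / 2 ^ (n / 10))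
    (by rw [hcardβ, hcardH]; exact Nat.mul_div_le _ _)
  set A : Finset (Fin n → ZMod 3) := univ.filter fun g => c' g = κ with hA
  have hmemA : ∀ g ∈ A, c (N g) = κ := fun g hg => (mem_filter.1 hg).2
  -- no line ⇒ tricolored sum-free
  have hTSF : IsTricoloredSumFree (fun i : A => (i : Fin n → ZMod 3)) (fun i : A => (i : Fin n → ZMod 3))
      (fun i : A => (i : Fin n → ZMod 3)) := by
    intro i j k
    constructor
    · intro hsum
      have hl : ∀ l, (i : Fin n → ZMod 3) l + (j : Fin n → ZMod 3) l + (k : Fin n → ZMod 3) l = 0 := fun l => by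
        have := congrFun hsum l
        simpa using this
      by_contra hne
      -- pairwise distinct vectors
      have hall : ∀ (e : (i : Fin n → ZMod 3) = j ∨ (j : Fin n → ZMod 3) = k ∨ (i : Fin n → ZMod 3) = k), False := by
        intro e
        apply hne
        rcases e with e | e | e
        · have hk : (k : Fin n → ZMod 3) = i := funext fun l => d1 _ _ (by rw [← e] at hl; exact hl l)
          exact ⟨Subtype.ext e, Subtype.ext (e.symm.trans hk.symm)⟩
        · have hi : (i : Fin n → ZMod 3) = j := funext fun l => d2 _ _ (by rw [e] at hl ⊢; exact hl l)
          exact ⟨Subtype.ext hi, Subtype.ext e⟩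
        · have hj : (j : Fin n → ZMod 3) = i := funext fun l => d3 _ _ (by rw [← e] at hl; exact hl l)
          exact ⟨Subtype.ext hj.symm, Subtype.ext (hj.trans e)⟩
      have hij : N i ≠ N j := fun h => hall (Or.inl (hNinj h))
      have hjk : N j ≠ N k := fun h => hall (Or.inr (Or.inl (hNinj h)))
      have hik : N i ≠ N k := fun h => hall (Or.inr (Or.inr (hNinj h)))
      apply hno
      refine ⟨N i, N j, N k, ?_, ?_, ?_⟩
      · show N i < 3 ^ n ∧ N j < 3 ^ n ∧ N k < 3 ^ n ∧ N i ≠ N j ∧ N j ≠ N k ∧ N i ≠ N k ∧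
          ∀ l : ℕ, l < n → (N i / 3 ^ l % 3 + N j / 3 ^ l % 3 + N k / 3 ^ l % 3) % 3 = 0
        refine ⟨hNlt _, hNlt _, hNlt _, hij, hjk, hik, fun l hln => ?_⟩
        rw [hNdig _ l hln, hNdig _ l hln, hNdig _ l hln]
        have h := congrArg ZMod.val (hl ⟨l, hln⟩)
        rw [ZMod.val_add, ZMod.val_add, ZMod.val_zero] at h
        omega
      · rw [hmemA _ i.2, hmemA _ j.2]
      · rw [hmemA _ j.2, hmemA _ k.2]
    · rintro ⟨rfl, rfl⟩
      funext l
      simpa using d0 ((i : Fin n → ZMod 3) l)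
  -- the slice-rank bound
  have hTS := IsTricoloredSumFree.card_le_of_addEquiv (p := 3) (q := 3) 1 (by norm_num) (κ := Fin n) (G' := Unit)
    (AddEquiv.prodUnique (M := Fin n → ZMod 3) (N := Unit)).symm hTSF
  rw [Fintype.card_coe, Fintype.card_unit, mul_one] at hTS
  -- the low-weight count
  have hLW := card_lowWeight_mul_pow_le 3 (Fin n) (21 / 25 : ℝ) (by norm_num) (by norm_num)
  simp only [Fintype.card_fin, Finset.sum_range_succ, Finset.sum_range_zero, zero_add, mul_zero, pow_zero,
    show 3 - 1 = 2 from rfl] at hLW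
  -- hLW : ↑(card LW) * (21/25)^(2*n) ≤ (1 + (21/25)^(3*1) + (21/25)^(3*2))^n
  set L := Fintype.card (LowWeight 3 (Fin n)) with hL
  have hθ : (L : ℝ) ≤ ((1 + (21 / 25 : ℝ) ^ 3 + (21 / 25) ^ 6) / (21 / 25) ^ 2) ^ n := by
    rw [div_pow, le_div_iff₀ (by positivity), ← pow_mul]
    simpa [mul_comm] using hLW
  have hnum := monoLine_numeric n hn
  -- the counting contradiction
  have hM : 3 ^ n / 2 ^ (n / 10) ≤ A.card := hκ
  have hdivlt : 3 ^ n < (3 ^ n / 2 ^ (n / 10) + 1) * 2 ^ (n / 10) := by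
    have := Nat.lt_div_mul_add (a := 3 ^ n) (pow_pos two_pos (n / 10))
    linarith
  have hchain : (3 : ℝ) ^ n < (3 * L + 1) * 2 ^ (n / 10) := by
    have h1 : ((3 ^ n : ℕ) : ℝ) < ((3 ^ n / 2 ^ (n / 10) + 1 : ℕ) : ℝ) * ((2 ^ (n / 10) : ℕ) : ℝ) := by
      exact_mod_cast hdivlt
    push_cast at h1
    calc (3 : ℝ) ^ n < ((3 ^ n / 2 ^ (n / 10) : ℕ) + 1) * 2 ^ (n / 10) := h1
      _ ≤ (3 * L + 1) * 2 ^ (n / 10) := by gcongr; exact_mod_cast (by omega : 3 ^ n / 2 ^ (n / 10) ≤ 3 * L)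
  set θn := ((1 + (21 / 25 : ℝ) ^ 3 + (21 / 25) ^ 6) / (21 / 25) ^ 2) ^ n with hθn
  have hθn1 : 1 ≤ θn := by
    rw [hθn]
    exact one_le_pow₀ (by norm_num)
  have : (3 * (L : ℝ) + 1) * 2 ^ (n / 10) ≤ 4 * 2 ^ (n / 10) * θn := by nlinarith [hθ, hθn1, pow_pos (two_pos : (0:ℝ) < 2) (n / 10)]
  linarith

end Summit.PneNP.PneNP.Theorems
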